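import Literature.NumberTheory.LFunctions.HardyZSqTwistedMoment
import Literature.NumberTheory.LFunctions.PlateauMollifier
import HarnessLib

/-!
# The mollified mean square `∫_T^{T₂} Z(t)² |ψ(1/2+it)|² dt` (Titchmarsh §9.24, Selberg)

Topic `Literature/NumberTheory/LFunctions`.

Titchmarsh, *The Theory of the Riemann Zeta-Function*, §9.24 (proof of Theorem 9.24, after
Selberg 1942) considers `∫_T^{T+U} |ζ(1/2+it)|² |ψ(1/2+it)|² dt` for a mollifier
`ψ(s) = ∑_{r < X} δ_r r^{1/2 - s}`… here `ψ(s) = ∑_{d ≤ X} w_d d^{-s}` with the **plateau weights**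
`w_d = μ(d) max(0, min(1, 2 log(X/d)/log X))` of
`Literature.NumberTheory.LFunctions.PlateauMollifier.weight` (equal to `μ(d)` for `d ≤ X^{1/2}`,
which is what the later power-saving step needs; Selberg's `δ_r` would do equally well for the
present file). Expanding `|ψ|²` and applying Lemma 9.23
(`Literature.NumberTheory.LFunctions.TwistedMoment.lemma923`) to each pair `(q, r)` with
`m = q/(q,r)`, `n = r/(q,r)`, the main terms add up to
`U {(log(T/2π) + 2γ) Q₁ − 2 Q₂ + 2 Q₃}` with the three quadratic forms of
`Literature.NumberTheory.LFunctions.PlateauMollifier.quadForm_le`,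
`Literature.NumberTheory.LFunctions.PlateauMollifier.abs_quadForm_log_le`,
`Literature.NumberTheory.LFunctions.PlateauMollifier.quadForm_logGcd_le`
(`Q₁ = O(1/log X)`, `Q₂, Q₃ = O(1)` — the computation of Titchmarsh pp. 231–232), and the error
terms add up to at most `4X` times the error of Lemma 9.23:

* `Literature.NumberTheory.LFunctions.TwistedMoment.plateauMollifier X s = ∑_{d ≤ X} w_d d^{-s}`
  (DEFINITION);
* `Literature.NumberTheory.LFunctions.TwistedMoment.mollified_meanSquare_le` — there are `C₄, t₉`
  with `∫_T^{T₂} Z² |ψ_X(1/2+it)|² dt ≤ C₄ {U (1 + log T/log X) + X·E(T, X, U, ε)}` for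
  `t₉ ≤ T ≤ T₂ ≤ 2T`, `3 ≤ X`, `4X ≤ ⌊(T/2π)^{1/2}⌋`, `0 < ε ≤ 1`, where `E` is the error
  expression of `lemma923`. With `X = T^θ`, `U = T^a` (`0.9 + θ < a < 1 − 2θ`) and
  `ε = 1/(X log T)` this is Selberg's `∫_T^{T+U} |ζψ|² dt = O(U log T/log X)` (Titchmarsh p. 232,
  "`= O(U log T / log X)`"), the input of the convexity argument of §9.24.

## References

* E. C. Titchmarsh, *The Theory of the Riemann Zeta-Function*, 2nd ed. (rev. D. R. Heath-Brown),
  Oxford 1986, §9.24, pp. 230–233. [cite: Titchmarsh1986, §9.24]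
* A. Selberg, *On the zeros of Riemann's zeta-function*, Skr. Norske Vid.-Akad. Oslo I 1942, no. 10.
-/

noncomputable section

open Finset Real Complex MeasureTheory intervalIntegral
open scoped ComplexConjugate
open Literature.NumberTheory.LFunctions.PlateauMollifier (weight abs_weight_le_one)

namespace Literature.NumberTheory.LFunctions.TwistedMoment

/-! ### The mollifier -/

/-- The **mollifier with plateau weights** `ψ_X(s) = ∑_{d ≤ X} w_d d^{-s}`,
`w_d = Literature.NumberTheory.LFunctions.PlateauMollifier.weight X d = μ(d) max(0, min(1, 2 log(X/d)/log X))`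
(Selberg's `ψ` of Titchmarsh §9.24 with the weights `δ_r` replaced by the plateau weights; both are
`μ(d)(1 + o(1))` for small `d` and supported on `d < X`). [cite: Titchmarsh1986, §9.24] -/
def plateauMollifier (X : ℝ) (s : ℂ) : ℂ :=
  ∑ d ∈ Finset.Icc 1 ⌊X⌋₊, ((weight X d : ℝ) : ℂ) * (d : ℂ) ^ (-s)

/-- Unfolding lemma for `plateauMollifier`. [folklore] -/
theorem plateauMollifier_def (X : ℝ) (s : ℂ) :
    plateauMollifier X s = ∑ d ∈ Finset.Icc 1 ⌊X⌋₊, ((weight X d : ℝ) : ℂ) * (d : ℂ) ^ (-s) := rfl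

/-- On the critical line: `ψ_X(1/2+it) = ∑ w_d d^{-1/2} e^{-it log d}`. [folklore] -/
theorem plateauMollifier_half (X t : ℝ) : plateauMollifier X (1 / 2 + t * I) =
    ∑ d ∈ Finset.Icc 1 ⌊X⌋₊, ((weight X d : ℝ) : ℂ) *
      ((((d : ℝ) ^ (-(1 / 2 : ℝ)) : ℝ) : ℂ) * cexp (-(I * t * Real.log d))) := by
  refine Finset.sum_congr rfl fun d hd => ?_
  rw [show -(1 / 2 + (t : ℂ) * I) = -(1 / 2 : ℂ) - t * I by ring,
    natCast_cpow_neg_half_sub_eq (Finset.mem_Icc.1 hd).1 t]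

/-- `|ψ_X(1/2+it)| ≤ 2 X^{1/2}` (crude). [folklore] -/
theorem norm_plateauMollifier_half_le {X : ℝ} (hX : 0 ≤ X) (t : ℝ) :
    ‖plateauMollifier X (1 / 2 + t * I)‖ ≤ 2 * Real.sqrt X := by
  rw [plateauMollifier_half]
  refine (norm_sum_le _ _).trans ?_
  have hfl : Real.sqrt (⌊X⌋₊ : ℝ) ≤ Real.sqrt X := Real.sqrt_le_sqrt (Nat.floor_le hX)
  refine le_trans (le_trans (Finset.sum_le_sum fun d hd => ?_) (sum_Icc_rpow_neg_half_le ⌊X⌋₊)) (by linarith)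
  have hd0 : (0 : ℝ) < d := by exact_mod_cast (Finset.mem_Icc.1 hd).1
  rw [norm_mul, norm_mul, Complex.norm_real, Complex.norm_real, Real.norm_eq_abs, Real.norm_eq_abs,
    abs_of_nonneg (Real.rpow_nonneg hd0.le _),
    show -(I * (t : ℂ) * (Real.log d : ℂ)) = ((-(t * Real.log d) : ℝ) : ℂ) * I by push_cast; ring,
    Complex.norm_exp_ofReal_mul_I, mul_one]
  have := abs_weight_le_one X d
  have h0 : 0 ≤ (d : ℝ) ^ (-(1 / 2 : ℝ)) := Real.rpow_nonneg hd0.le _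
  nlinarith

/-! ### `log r − log q = log(r/(q,r)) − log(q/(q,r))` -/

/-- For `q, r ≥ 1` with `g = (q, r)`: `log r − log q = log (r/g) − log (q/g)`. [folklore] -/
theorem log_sub_log_eq_div_gcd {q r : ℕ} (hq : 0 < q) (hr : 0 < r) :
    Real.log r - Real.log q =
      Real.log ((r / Nat.gcd q r : ℕ) : ℝ) - Real.log ((q / Nat.gcd q r : ℕ) : ℝ) := by
  have hg : 0 < Nat.gcd q r := Nat.gcd_pos_of_pos_left r hq
  have hgR : (0 : ℝ) < Nat.gcd q r := by exact_mod_cast hg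
  rw [Nat.cast_div (Nat.gcd_dvd_right q r) hgR.ne', Nat.cast_div (Nat.gcd_dvd_left q r) hgR.ne',
    Real.log_div (by exact_mod_cast hr.ne') hgR.ne', Real.log_div (by exact_mod_cast hq.ne') hgR.ne']
  ring

/-- `|ψ|² = ψ ψ̄ = ∑_q ∑_r w_q w_r (qr)^{-1/2} e^{it(log(r/g) − log(q/g))}`, `g = (q,r)`. [folklore] -/
theorem mul_conj_plateauMollifier_half (X t : ℝ) :
    plateauMollifier X (1 / 2 + t * I) * conj (plateauMollifier X (1 / 2 + t * I)) =
      ∑ q ∈ Finset.Icc 1 ⌊X⌋₊, ∑ r ∈ Finset.Icc 1 ⌊X⌋₊,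
        ((weight X q * weight X r * ((q : ℝ) ^ (-(1 / 2 : ℝ)) * (r : ℝ) ^ (-(1 / 2 : ℝ))) : ℝ) : ℂ) *
          cexp (I * t * ((Real.log ((r / Nat.gcd q r : ℕ) : ℝ) - Real.log ((q / Nat.gcd q r : ℕ) : ℝ) : ℝ) : ℂ)) := by
  rw [plateauMollifier_half, map_sum, Finset.sum_mul_sum]
  refine Finset.sum_congr rfl fun q hq => Finset.sum_congr rfl fun r hr => ?_
  have hq0 : 0 < q := (Finset.mem_Icc.1 hq).1
  have hr0 : 0 < r := (Finset.mem_Icc.1 hr).1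
  rw [map_mul, Complex.conj_ofReal, conj_term, ← log_sub_log_eq_div_gcd hq0 hr0]
  have : cexp (-(I * t * Real.log q)) * cexp (I * t * Real.log r) =
      cexp (I * t * ((Real.log r - Real.log q : ℝ) : ℂ)) := by
    rw [← Complex.exp_add]; push_cast; ring_nf
  calc ((weight X q : ℝ) : ℂ) * ((((q : ℝ) ^ (-(1 / 2 : ℝ)) : ℝ) : ℂ) * cexp (-(I * t * Real.log q)))
        * (((weight X r : ℝ) : ℂ) * ((((r : ℝ) ^ (-(1 / 2 : ℝ)) : ℝ) : ℂ) * cexp (I * t * Real.log r)))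
      = ((weight X q : ℝ) : ℂ) * ((weight X r : ℝ) : ℂ) * ((((q : ℝ) ^ (-(1 / 2 : ℝ)) : ℝ) : ℂ))
          * ((((r : ℝ) ^ (-(1 / 2 : ℝ)) : ℝ) : ℂ)) * (cexp (-(I * t * Real.log q)) * cexp (I * t * Real.log r)) := by
          ring
    _ = _ := by rw [this]; push_cast; ring

/-! ### Expanding `∫ Z² |ψ|²` -/

/-- **`∫_T^{T₂} Z² |ψ|² = ∑_q ∑_r w_q w_r (qr)^{-1/2} ∫_T^{T₂} Z² e^{it(log n − log m)} dt`**
(`m = q/(q,r)`, `n = r/(q,r)`), as complex numbers. [cite: Titchmarsh1986, §9.24] -/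
theorem integral_Zsq_normSq_eq (X T T₂ : ℝ) :
    (((∫ t in T..T₂, (hardyZ t) ^ 2 * ‖plateauMollifier X (1 / 2 + t * I)‖ ^ 2 : ℝ)) : ℂ) =
      ∑ q ∈ Finset.Icc 1 ⌊X⌋₊, ∑ r ∈ Finset.Icc 1 ⌊X⌋₊,
        ((weight X q * weight X r * ((q : ℝ) ^ (-(1 / 2 : ℝ)) * (r : ℝ) ^ (-(1 / 2 : ℝ))) : ℝ) : ℂ) *
          ∫ t in T..T₂, ((hardyZ t : ℂ)) ^ 2 *
            cexp (I * t * ((Real.log ((r / Nat.gcd q r : ℕ) : ℝ) - Real.log ((q / Nat.gcd q r : ℕ) : ℝ) : ℝ) : ℂ)) := by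
  rw [← intervalIntegral.integral_ofReal]
  have hpt : ∀ t : ℝ, (((hardyZ t) ^ 2 * ‖plateauMollifier X (1 / 2 + t * I)‖ ^ 2 : ℝ) : ℂ) =
      ∑ q ∈ Finset.Icc 1 ⌊X⌋₊, ∑ r ∈ Finset.Icc 1 ⌊X⌋₊,
        ((weight X q * weight X r * ((q : ℝ) ^ (-(1 / 2 : ℝ)) * (r : ℝ) ^ (-(1 / 2 : ℝ))) : ℝ) : ℂ) *
          (((hardyZ t : ℂ)) ^ 2 *
            cexp (I * t * ((Real.log ((r / Nat.gcd q r : ℕ) : ℝ) - Real.log ((q / Nat.gcd q r : ℕ) : ℝ) : ℝ) : ℂ))) := by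
    intro t
    have hns : ((‖plateauMollifier X (1 / 2 + t * I)‖ ^ 2 : ℝ) : ℂ) =
        plateauMollifier X (1 / 2 + t * I) * conj (plateauMollifier X (1 / 2 + t * I)) := by
      rw [Complex.mul_conj, Complex.normSq_eq_norm_sq, Complex.ofReal_pow]
    rw [Complex.ofReal_mul, Complex.ofReal_pow, hns, mul_conj_plateauMollifier_half, Finset.mul_sum]
    refine Finset.sum_congr rfl fun q _ => ?_
    rw [Finset.mul_sum]
    refine Finset.sum_congr rfl fun r _ => ?_
    ring
  rw [intervalIntegral.integral_congr fun t _ => hpt t]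
  have hcont : ∀ q r : ℕ, Continuous fun t : ℝ => ((hardyZ t : ℂ)) ^ 2 *
      cexp (I * t * ((Real.log ((r / Nat.gcd q r : ℕ) : ℝ) - Real.log ((q / Nat.gcd q r : ℕ) : ℝ) : ℝ) : ℂ)) := by
    intro q r
    exact ((Complex.continuous_ofReal.comp continuous_hardyZ).pow 2).mul
      (continuous_twist (q / Nat.gcd q r) (r / Nat.gcd q r))
  have hint : ∀ q r : ℕ, IntervalIntegrable (fun t : ℝ =>
      ((weight X q * weight X r * ((q : ℝ) ^ (-(1 / 2 : ℝ)) * (r : ℝ) ^ (-(1 / 2 : ℝ))) : ℝ) : ℂ) *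
        (((hardyZ t : ℂ)) ^ 2 *
          cexp (I * t * ((Real.log ((r / Nat.gcd q r : ℕ) : ℝ) - Real.log ((q / Nat.gcd q r : ℕ) : ℝ) : ℝ) : ℂ))))
      volume T T₂ := fun q r => (continuous_const.mul (hcont q r)).intervalIntegrable _ _
  rw [intervalIntegral.integral_finsetSum fun q _ => ?_]
  · refine Finset.sum_congr rfl fun q _ => ?_
    rw [intervalIntegral.integral_finsetSum fun r _ => hint q r]
    refine Finset.sum_congr rfl fun r _ => ?_
    exact intervalIntegral.integral_const_mul _ _
  · have := IntervalIntegrable.sum (Finset.Icc 1 ⌊X⌋₊) fun r (_ : r ∈ Finset.Icc 1 ⌊X⌋₊) => hint q r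
    refine this.congr fun t => ?_
    simp [Finset.sum_apply]

/-- The main term of one pair: with `g = (q,r)`, `m = q/g`, `n = r/g`,
`w_q w_r (qr)^{-1/2} · (U/(mn)^{1/2}) (log(T/(2πmn)) + 2γ) = U w_q w_r (g/(qr)) (log(T/2π) + 2γ − log q − log r + 2 log g)`.
[cite: Titchmarsh1986, §9.24] -/
theorem pair_mainTerm_eq {q r : ℕ} (hq : 0 < q) (hr : 0 < r) {T : ℝ} (hT : 0 < T) (X U : ℝ) :
    (weight X q * weight X r * ((q : ℝ) ^ (-(1 / 2 : ℝ)) * (r : ℝ) ^ (-(1 / 2 : ℝ)))) *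
      (U / Real.sqrt (((q / Nat.gcd q r : ℕ) : ℝ) * ((r / Nat.gcd q r : ℕ) : ℝ)) *
        (Real.log (T / (2 * π * ((q / Nat.gcd q r : ℕ) : ℝ) * ((r / Nat.gcd q r : ℕ) : ℝ)))
          + 2 * Real.eulerMascheroniConstant)) =
    U * (weight X q * weight X r * (Nat.gcd q r : ℝ) / ((q : ℝ) * r)) *
      (Real.log (T / (2 * π)) + 2 * Real.eulerMascheroniConstant - Real.log q - Real.log r
        + 2 * Real.log (Nat.gcd q r)) := by
  have hg : 0 < Nat.gcd q r := Nat.gcd_pos_of_pos_left r hq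
  have hgR : (0 : ℝ) < Nat.gcd q r := by exact_mod_cast hg
  have hqR : (0 : ℝ) < q := by exact_mod_cast hq
  have hrR : (0 : ℝ) < r := by exact_mod_cast hr
  have hm : ((q / Nat.gcd q r : ℕ) : ℝ) = q / Nat.gcd q r := Nat.cast_div (Nat.gcd_dvd_left q r) hgR.ne'
  have hn : ((r / Nat.gcd q r : ℕ) : ℝ) = r / Nat.gcd q r := Nat.cast_div (Nat.gcd_dvd_right q r) hgR.ne'
  rw [hm, hn]
  set g : ℝ := ((Nat.gcd q r : ℕ) : ℝ) with hgdef
  -- the square roots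
  have hsqrt : Real.sqrt (q / g * (r / g)) = Real.sqrt q * Real.sqrt r / g := by
    rw [show (q : ℝ) / g * (r / g) = (q * r) / g ^ 2 by field_simp, Real.sqrt_div' _ (by positivity),
      Real.sqrt_sq hgR.le, Real.sqrt_mul hqR.le]
  have hpq : (q : ℝ) ^ (-(1 / 2 : ℝ)) = (Real.sqrt q)⁻¹ := by rw [Real.rpow_neg hqR.le, ← Real.sqrt_eq_rpow]
  have hpr : (r : ℝ) ^ (-(1 / 2 : ℝ)) = (Real.sqrt r)⁻¹ := by rw [Real.rpow_neg hrR.le, ← Real.sqrt_eq_rpow]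
  have hlog : Real.log (T / (2 * π * (q / g) * (r / g))) =
      Real.log (T / (2 * π)) - Real.log q - Real.log r + 2 * Real.log g := by
    rw [show T / (2 * π * (q / g) * (r / g)) = T / (2 * π) / q / r * g ^ 2 by field_simp]
    rw [Real.log_mul (by positivity) (by positivity), Real.log_div (by positivity) hrR.ne',
      Real.log_div (by positivity) hqR.ne', Real.log_pow]
    push_cast; ring
  rw [hsqrt, hpq, hpr, hlog]
  have hsq : Real.sqrt q * Real.sqrt q = q := Real.mul_self_sqrt hqR.le
  have hsr : Real.sqrt r * Real.sqrt r = r := Real.mul_self_sqrt hrR.le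
  have hsq0 : 0 < Real.sqrt q := Real.sqrt_pos.2 hqR
  have hsr0 : 0 < Real.sqrt r := Real.sqrt_pos.2 hrR
  set a := Real.sqrt q with ha
  set b := Real.sqrt r with hb
  set Lq := Real.log (q : ℝ) with hLq
  set Lr := Real.log (r : ℝ) with hLr
  set Lg := Real.log g with hLg
  set L0 := Real.log (T / (2 * π)) with hL0
  rw [← hsq, ← hsr]
  field_simp
  ring

/-- Summing the main terms: `∑_q ∑_r w_q w_r (g/(qr))(A − log q − log r + 2 log g) = A Q₁ − 2 Q₂ + 2 Q₃`
with the quadratic forms of `PlateauMollifier` (the `log r`-form equals the `log q`-form by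
symmetry). [cite: Titchmarsh1986, §9.24] -/
theorem sum_pair_mainTerm_eq (X A : ℝ) (N : ℕ) :
    ∑ q ∈ Finset.Icc 1 N, ∑ r ∈ Finset.Icc 1 N,
        (weight X q * weight X r * (Nat.gcd q r : ℝ) / ((q : ℝ) * r)) *
          (A - Real.log q - Real.log r + 2 * Real.log (Nat.gcd q r)) =
      A * ∑ q ∈ Finset.Icc 1 N, ∑ r ∈ Finset.Icc 1 N, weight X q * weight X r * (Nat.gcd q r : ℝ) / ((q : ℝ) * r)
      - 2 * ∑ q ∈ Finset.Icc 1 N, ∑ r ∈ Finset.Icc 1 N,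
          weight X q * weight X r * (Nat.gcd q r : ℝ) * Real.log q / ((q : ℝ) * r)
      + 2 * ∑ q ∈ Finset.Icc 1 N, ∑ r ∈ Finset.Icc 1 N,
          weight X q * weight X r * (Nat.gcd q r : ℝ) * Real.log (Nat.gcd q r) / ((q : ℝ) * r) := by
  -- the `log r` sum equals the `log q` sum
  have hsymm : ∑ q ∈ Finset.Icc 1 N, ∑ r ∈ Finset.Icc 1 N,
      weight X q * weight X r * (Nat.gcd q r : ℝ) * Real.log r / ((q : ℝ) * r) =
      ∑ q ∈ Finset.Icc 1 N, ∑ r ∈ Finset.Icc 1 N,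
        weight X q * weight X r * (Nat.gcd q r : ℝ) * Real.log q / ((q : ℝ) * r) := by
    rw [Finset.sum_comm]
    refine Finset.sum_congr rfl fun q _ => Finset.sum_congr rfl fun r _ => ?_
    rw [Nat.gcd_comm]; ring
  have hexp : ∀ q r : ℕ, (weight X q * weight X r * (Nat.gcd q r : ℝ) / ((q : ℝ) * r)) *
      (A - Real.log q - Real.log r + 2 * Real.log (Nat.gcd q r)) =
      A * (weight X q * weight X r * (Nat.gcd q r : ℝ) / ((q : ℝ) * r))
        - weight X q * weight X r * (Nat.gcd q r : ℝ) * Real.log q / ((q : ℝ) * r)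
        - weight X q * weight X r * (Nat.gcd q r : ℝ) * Real.log r / ((q : ℝ) * r)
        + 2 * (weight X q * weight X r * (Nat.gcd q r : ℝ) * Real.log (Nat.gcd q r) / ((q : ℝ) * r)) := by
    intro q r; ring
  simp only [hexp, Finset.sum_add_distrib, Finset.sum_sub_distrib, ← Finset.mul_sum]
  rw [hsymm]; ring

/-- `∑_q ∑_r |w_q w_r| (qr)^{-1/2} ≤ 4N`. [folklore] -/
theorem sum_abs_pairCoeff_le (X : ℝ) (N : ℕ) :
    ∑ q ∈ Finset.Icc 1 N, ∑ r ∈ Finset.Icc 1 N,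
        |weight X q * weight X r * ((q : ℝ) ^ (-(1 / 2 : ℝ)) * (r : ℝ) ^ (-(1 / 2 : ℝ)))| ≤ 4 * N := by
  have hS := sum_Icc_rpow_neg_half_le N
  have hS0 : 0 ≤ ∑ n ∈ Finset.Icc 1 N, (n : ℝ) ^ (-(1 / 2 : ℝ)) :=
    Finset.sum_nonneg fun n _ => Real.rpow_nonneg (Nat.cast_nonneg n) _
  calc ∑ q ∈ Finset.Icc 1 N, ∑ r ∈ Finset.Icc 1 N,
        |weight X q * weight X r * ((q : ℝ) ^ (-(1 / 2 : ℝ)) * (r : ℝ) ^ (-(1 / 2 : ℝ)))|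
      ≤ ∑ q ∈ Finset.Icc 1 N, ∑ r ∈ Finset.Icc 1 N, (q : ℝ) ^ (-(1 / 2 : ℝ)) * (r : ℝ) ^ (-(1 / 2 : ℝ)) := by
        refine Finset.sum_le_sum fun q _ => Finset.sum_le_sum fun r _ => ?_
        have hq0 : 0 ≤ (q : ℝ) ^ (-(1 / 2 : ℝ)) := Real.rpow_nonneg (Nat.cast_nonneg q) _
        have hr0 : 0 ≤ (r : ℝ) ^ (-(1 / 2 : ℝ)) := Real.rpow_nonneg (Nat.cast_nonneg r) _
        rw [abs_mul, abs_mul, abs_of_nonneg (mul_nonneg hq0 hr0)]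
        have h1 := abs_weight_le_one X q
        have h2 := abs_weight_le_one X r
        have : |weight X q| * |weight X r| ≤ 1 := by nlinarith [abs_nonneg (weight X q), abs_nonneg (weight X r)]
        calc |weight X q| * |weight X r| * ((q : ℝ) ^ (-(1 / 2 : ℝ)) * (r : ℝ) ^ (-(1 / 2 : ℝ)))
            ≤ 1 * ((q : ℝ) ^ (-(1 / 2 : ℝ)) * (r : ℝ) ^ (-(1 / 2 : ℝ))) :=
              mul_le_mul_of_nonneg_right this (mul_nonneg hq0 hr0)
          _ = _ := one_mul _
    _ = (∑ q ∈ Finset.Icc 1 N, (q : ℝ) ^ (-(1 / 2 : ℝ))) * ∑ r ∈ Finset.Icc 1 N, (r : ℝ) ^ (-(1 / 2 : ℝ)) := by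
        rw [Finset.sum_mul_sum]
    _ ≤ (2 * Real.sqrt N) * (2 * Real.sqrt N) := mul_le_mul hS hS hS0 (by positivity)
    _ = 4 * N := by nlinarith [Real.mul_self_sqrt (Nat.cast_nonneg N)]

/-! ### The mollified mean square -/

set_option maxHeartbeats 1600000 in
/-- **The mollified mean square** (Titchmarsh §9.24 with plateau weights, Selberg 1942): there are
`C₄ > 0`, `t₉` such that for `t₉ ≤ T ≤ T₂ ≤ 2T`, `3 ≤ X`, `4X ≤ ⌊(T/2π)^{1/2}⌋`, `0 < ε ≤ 1`,
with `U = T₂ − T`,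
`∫_T^{T₂} Z(t)² |ψ_X(1/2+it)|² dt ≤ C₄ {U (1 + log T/log X) + X E}`,
`E = T^{9/10} + X^{3/2} T^{1/2} (1+log T)² + X^{1/2} U²/T + X U/T^{1/2} + ε U (1+log T) + ε⁻¹(1 + U/T^{1/2} + U²/T)`
(main term `U{(log(T/2π)+2γ) Q₁ − 2Q₂ + 2Q₃} = O(U log T/log X)`, error `≤ 4X ·` the error of
Lemma 9.23; printed: "`∫_T^{T+U} |ζ(1/2+it)|² |ψ(1/2+it)|² dt = O(U log T/log X)`").
[cite: Titchmarsh1986, §9.24] -/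
theorem mollified_meanSquare_le : ∃ C₄ t₉ : ℝ, 0 < C₄ ∧ 400 ≤ t₉ ∧ ∀ (T T₂ X ε : ℝ), t₉ ≤ T → T ≤ T₂ →
    T₂ ≤ 2 * T → 3 ≤ X → 4 * X ≤ (⌊Real.sqrt (T / (2 * π))⌋₊ : ℝ) → 0 < ε → ε ≤ 1 →
    ∫ t in T..T₂, (hardyZ t) ^ 2 * ‖plateauMollifier X (1 / 2 + t * I)‖ ^ 2 ≤
      C₄ * ((T₂ - T) * (1 + Real.log T / Real.log X)
        + X * (T ^ (9 / 10 : ℝ) + X ^ (3 / 2 : ℝ) * Real.sqrt T * (1 + Real.log T) ^ 2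
          + Real.sqrt X * (T₂ - T) ^ 2 / T + X * (T₂ - T) / Real.sqrt T
          + ε * (T₂ - T) * (1 + Real.log T) + ε⁻¹ * (1 + (T₂ - T) / Real.sqrt T + (T₂ - T) ^ 2 / T))) := by
  obtain ⟨C, t₉, hC, ht₉, h923⟩ := lemma923
  obtain ⟨C₁, hQ₁⟩ := Literature.NumberTheory.LFunctions.PlateauMollifier.quadForm_le
  obtain ⟨C₂, hQ₂⟩ := Literature.NumberTheory.LFunctions.PlateauMollifier.abs_quadForm_log_le
  obtain ⟨C₃, hQ₃⟩ := Literature.NumberTheory.LFunctions.PlateauMollifier.quadForm_logGcd_le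
  -- the constants are nonnegative (test at `X = 3`)
  have hlog3 : 0 < Real.log 3 := Real.log_pos (by norm_num)
  have hC₁0 : 0 ≤ C₁ := by
    obtain ⟨h0, h1⟩ := hQ₁ 3 le_rfl
    have := h0.trans h1
    rwa [le_div_iff₀ hlog3, zero_mul] at this
  have hC₂0 : 0 ≤ C₂ := (abs_nonneg _).trans (hQ₂ 3 le_rfl)
  have hC₃0 : 0 ≤ C₃ := by obtain ⟨h0, h1⟩ := hQ₃ 3 le_rfl; exact h0.trans h1
  refine ⟨3 * C₁ + 2 * C₂ + 2 * C₃ + 4 * C + 1, t₉, by positivity, ht₉, ?_⟩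
  intro T T₂ X ε hT hTT₂ hT₂ hX3 h4X hε hε1
  have hT400 : (400 : ℝ) ≤ T := ht₉.trans hT
  have hT0 : 0 < T := by linarith
  have hX0 : 0 < X := by linarith
  set N := ⌊X⌋₊ with hN
  set U := T₂ - T with hU
  have hU0 : 0 ≤ U := by rw [hU]; linarith
  have hNX : (N : ℝ) ≤ X := Nat.floor_le hX0.le
  set E := T ^ (9 / 10 : ℝ) + X ^ (3 / 2 : ℝ) * Real.sqrt T * (1 + Real.log T) ^ 2
      + Real.sqrt X * U ^ 2 / T + X * U / Real.sqrt T
      + ε * U * (1 + Real.log T) + ε⁻¹ * (1 + U / Real.sqrt T + U ^ 2 / T) with hE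
  have hLT : 0 ≤ Real.log T := Real.log_nonneg (by linarith)
  have hE0 : 0 ≤ E := by rw [hE]; positivity
  -- coefficients, twists, main terms
  set c : ℕ → ℕ → ℝ := fun q r =>
    weight X q * weight X r * ((q : ℝ) ^ (-(1 / 2 : ℝ)) * (r : ℝ) ^ (-(1 / 2 : ℝ))) with hc
  set J : ℕ → ℕ → ℂ := fun q r => ∫ t in T..T₂, ((hardyZ t : ℂ)) ^ 2 *
    cexp (I * t * ((Real.log ((r / Nat.gcd q r : ℕ) : ℝ) - Real.log ((q / Nat.gcd q r : ℕ) : ℝ) : ℝ) : ℂ)) with hJ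
  set M : ℕ → ℕ → ℝ := fun q r =>
    U / Real.sqrt (((q / Nat.gcd q r : ℕ) : ℝ) * ((r / Nat.gcd q r : ℕ) : ℝ)) *
      (Real.log (T / (2 * π * ((q / Nat.gcd q r : ℕ) : ℝ) * ((r / Nat.gcd q r : ℕ) : ℝ)))
        + 2 * Real.eulerMascheroniConstant) with hM
  -- (1) the expansion
  have hexp := integral_Zsq_normSq_eq X T T₂
  -- (2) Lemma 9.23 for each pair
  have hpair : ∀ q ∈ Finset.Icc 1 N, ∀ r ∈ Finset.Icc 1 N, ‖J q r - ((M q r : ℝ) : ℂ)‖ ≤ C * E := by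
    intro q hq r hr
    have hq1 : 1 ≤ q := (Finset.mem_Icc.1 hq).1
    have hr1 : 1 ≤ r := (Finset.mem_Icc.1 hr).1
    have hqN : q ≤ N := (Finset.mem_Icc.1 hq).2
    have hrN : r ≤ N := (Finset.mem_Icc.1 hr).2
    have hg : 0 < Nat.gcd q r := Nat.gcd_pos_of_pos_left r hq1
    have hm1 : 1 ≤ q / Nat.gcd q r := (Nat.le_div_iff_mul_le hg).2 (by simpa using Nat.gcd_le_left r hq1)
    have hn1 : 1 ≤ r / Nat.gcd q r := (Nat.le_div_iff_mul_le hg).2 (by simpa using Nat.gcd_le_right q hr1)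
    have hcop : Nat.Coprime (q / Nat.gcd q r) (r / Nat.gcd q r) := Nat.coprime_div_gcd_div_gcd hg
    have hmX : ((q / Nat.gcd q r : ℕ) : ℝ) ≤ X := by
      have : ((q / Nat.gcd q r : ℕ) : ℝ) ≤ q := by exact_mod_cast Nat.div_le_self q _
      exact this.trans ((show (q : ℝ) ≤ N by exact_mod_cast hqN).trans hNX)
    have hnX : ((r / Nat.gcd q r : ℕ) : ℝ) ≤ X := by
      have : ((r / Nat.gcd q r : ℕ) : ℝ) ≤ r := by exact_mod_cast Nat.div_le_self r _
      exact this.trans ((show (r : ℝ) ≤ N by exact_mod_cast hrN).trans hNX)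
    have h := h923 T T₂ X ε (q / Nat.gcd q r) (r / Nat.gcd q r) hT hTT₂ hT₂ hε hε1 hm1 hn1 hcop hmX hnX h4X
    simp only [hJ, hM, hU, hE]
    convert h using 2
  -- (3) the main terms
  have hmain_eq : ∀ q ∈ Finset.Icc 1 N, ∀ r ∈ Finset.Icc 1 N, c q r * M q r =
      U * (weight X q * weight X r * (Nat.gcd q r : ℝ) / ((q : ℝ) * r)) *
        (Real.log (T / (2 * π)) + 2 * Real.eulerMascheroniConstant - Real.log q - Real.log r
          + 2 * Real.log (Nat.gcd q r)) := by
    intro q hq r hr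
    exact pair_mainTerm_eq (Finset.mem_Icc.1 hq).1 (Finset.mem_Icc.1 hr).1 hT0 X U
  have hmain_sum : ∑ q ∈ Finset.Icc 1 N, ∑ r ∈ Finset.Icc 1 N, c q r * M q r =
      U * ((Real.log (T / (2 * π)) + 2 * Real.eulerMascheroniConstant) *
          ∑ q ∈ Finset.Icc 1 N, ∑ r ∈ Finset.Icc 1 N, weight X q * weight X r * (Nat.gcd q r : ℝ) / ((q : ℝ) * r)
        - 2 * ∑ q ∈ Finset.Icc 1 N, ∑ r ∈ Finset.Icc 1 N,
            weight X q * weight X r * (Nat.gcd q r : ℝ) * Real.log q / ((q : ℝ) * r)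
        + 2 * ∑ q ∈ Finset.Icc 1 N, ∑ r ∈ Finset.Icc 1 N,
            weight X q * weight X r * (Nat.gcd q r : ℝ) * Real.log (Nat.gcd q r) / ((q : ℝ) * r)) := by
    rw [Finset.sum_congr rfl fun q hq => Finset.sum_congr rfl fun r hr => hmain_eq q hq r hr]
    rw [← sum_pair_mainTerm_eq X _ N, Finset.mul_sum]
    refine Finset.sum_congr rfl fun q _ => ?_
    rw [Finset.mul_sum]
    refine Finset.sum_congr rfl fun r _ => by ring
  have hmain_le : ∑ q ∈ Finset.Icc 1 N, ∑ r ∈ Finset.Icc 1 N, c q r * M q r ≤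
      U * ((Real.log T + 2) * (C₁ / Real.log X) + 2 * C₂ + 2 * C₃) := by
    rw [hmain_sum]
    refine mul_le_mul_of_nonneg_left ?_ hU0
    obtain ⟨hQ₁0, hQ₁1⟩ := hQ₁ X hX3
    have hQ₂' := hQ₂ X hX3
    obtain ⟨hQ₃0, hQ₃1⟩ := hQ₃ X hX3
    rw [← hN] at hQ₁0 hQ₁1 hQ₂' hQ₃0 hQ₃1
    have hA0 : 0 ≤ Real.log (T / (2 * π)) + 2 * Real.eulerMascheroniConstant := by
      have : 0 ≤ Real.log (T / (2 * π)) := Real.log_nonneg (by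
        rw [le_div_iff₀ (by positivity)]; nlinarith [Real.pi_lt_d2])
      have := Real.one_half_lt_eulerMascheroniConstant; linarith
    have hA1 : Real.log (T / (2 * π)) + 2 * Real.eulerMascheroniConstant ≤ Real.log T + 2 := by
      have h1 : Real.log (T / (2 * π)) ≤ Real.log T :=
        Real.log_le_log (by positivity) (div_le_self hT0.le (by nlinarith [Real.pi_gt_three]))
      have := Real.eulerMascheroniConstant_lt_two_thirds; linarith
    have hQ₂abs := abs_le.1 hQ₂'
    have step1 : (Real.log (T / (2 * π)) + 2 * Real.eulerMascheroniConstant) *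
        ∑ q ∈ Finset.Icc 1 N, ∑ r ∈ Finset.Icc 1 N, weight X q * weight X r * (Nat.gcd q r : ℝ) / ((q : ℝ) * r)
        ≤ (Real.log T + 2) * (C₁ / Real.log X) :=
      mul_le_mul hA1 hQ₁1 hQ₁0 (by linarith)
    linarith [hQ₂abs.1, hQ₂abs.2]
  -- (4) the error terms
  have herr : ‖∑ q ∈ Finset.Icc 1 N, ∑ r ∈ Finset.Icc 1 N, ((c q r : ℝ) : ℂ) * (J q r - ((M q r : ℝ) : ℂ))‖ ≤
      4 * X * (C * E) := by
    refine (norm_sum_le _ _).trans ?_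
    calc ∑ q ∈ Finset.Icc 1 N, ‖∑ r ∈ Finset.Icc 1 N, ((c q r : ℝ) : ℂ) * (J q r - ((M q r : ℝ) : ℂ))‖
        ≤ ∑ q ∈ Finset.Icc 1 N, ∑ r ∈ Finset.Icc 1 N, |c q r| * (C * E) := by
          refine Finset.sum_le_sum fun q hq => (norm_sum_le _ _).trans (Finset.sum_le_sum fun r hr => ?_)
          rw [norm_mul, Complex.norm_real, Real.norm_eq_abs]
          exact mul_le_mul_of_nonneg_left (hpair q hq r hr) (abs_nonneg _)
      _ = (∑ q ∈ Finset.Icc 1 N, ∑ r ∈ Finset.Icc 1 N, |c q r|) * (C * E) := by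
          rw [Finset.sum_mul]; exact Finset.sum_congr rfl fun q _ => by rw [Finset.sum_mul]
      _ ≤ (4 * N) * (C * E) := mul_le_mul_of_nonneg_right (sum_abs_pairCoeff_le X N) (by positivity)
      _ ≤ 4 * X * (C * E) := by gcongr
  -- (5) assemble: the integral is the real part of `∑∑ c (M + (J − M))`
  set Ival := ∫ t in T..T₂, (hardyZ t) ^ 2 * ‖plateauMollifier X (1 / 2 + t * I)‖ ^ 2 with hIval
  have hIc : ((Ival : ℝ) : ℂ) = ((∑ q ∈ Finset.Icc 1 N, ∑ r ∈ Finset.Icc 1 N, c q r * M q r : ℝ) : ℂ)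
      + ∑ q ∈ Finset.Icc 1 N, ∑ r ∈ Finset.Icc 1 N, ((c q r : ℝ) : ℂ) * (J q r - ((M q r : ℝ) : ℂ)) := by
    rw [hIval, hexp, ← hN]
    push_cast
    rw [← Finset.sum_add_distrib]
    refine Finset.sum_congr rfl fun q _ => ?_
    rw [← Finset.sum_add_distrib]
    refine Finset.sum_congr rfl fun r _ => ?_
    simp only [hc, hJ]
    push_cast; ring
  have hre : Ival = (∑ q ∈ Finset.Icc 1 N, ∑ r ∈ Finset.Icc 1 N, c q r * M q r)
      + (∑ q ∈ Finset.Icc 1 N, ∑ r ∈ Finset.Icc 1 N, ((c q r : ℝ) : ℂ) * (J q r - ((M q r : ℝ) : ℂ))).re := by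
    have := congrArg Complex.re hIc
    simpa using this
  have hre_le : (∑ q ∈ Finset.Icc 1 N, ∑ r ∈ Finset.Icc 1 N, ((c q r : ℝ) : ℂ) * (J q r - ((M q r : ℝ) : ℂ))).re
      ≤ 4 * X * (C * E) := (Complex.re_le_norm _).trans herr
  -- (6) the final numerics
  have hLX : 1 ≤ Real.log X := by
    rw [Real.le_log_iff_exp_le hX0]
    have := Real.exp_one_lt_d9; linarith
  have hratio : 0 ≤ Real.log T / Real.log X := by positivity
  have hmain_le' : U * ((Real.log T + 2) * (C₁ / Real.log X) + 2 * C₂ + 2 * C₃) ≤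
      (3 * C₁ + 2 * C₂ + 2 * C₃) * (U * (1 + Real.log T / Real.log X)) := by
    have h1 : (Real.log T + 2) * (C₁ / Real.log X) = C₁ * (Real.log T / Real.log X) + 2 * (C₁ / Real.log X) := by
      ring
    have h2 : C₁ / Real.log X ≤ C₁ := div_le_self hC₁0 hLX
    have h3 : (Real.log T + 2) * (C₁ / Real.log X) + 2 * C₂ + 2 * C₃ ≤
        (3 * C₁ + 2 * C₂ + 2 * C₃) * (1 + Real.log T / Real.log X) := by
      rw [h1]; nlinarith [mul_nonneg hC₁0 hratio, mul_nonneg hC₂0 hratio, mul_nonneg hC₃0 hratio]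
    calc U * ((Real.log T + 2) * (C₁ / Real.log X) + 2 * C₂ + 2 * C₃)
        ≤ U * ((3 * C₁ + 2 * C₂ + 2 * C₃) * (1 + Real.log T / Real.log X)) :=
          mul_le_mul_of_nonneg_left h3 hU0
      _ = _ := by ring
  rw [hre]
  have hK0 : 0 ≤ U * (1 + Real.log T / Real.log X) := by positivity
  have hXE : 0 ≤ X * E := by positivity
  nlinarith [hmain_le, hmain_le', hre_le, mul_nonneg hC₁0 hXE, mul_nonneg hC₂0 hXE, mul_nonneg hC₃0 hXE,
    mul_nonneg hC.le hK0, hK0, hXE]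

end Literature.NumberTheory.LFunctions.TwistedMoment
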